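import Literature.IUT.LogThetaLattice.GlobalKummerNonInterference
import Mathlib.RingTheory.DedekindDomain.AdicValuation
import Mathlib.NumberTheory.NumberField.InfinitePlace.Embeddings
import HarnessLib

/-!
# [IUTchIII] Proposition 3.10 — proofs (companion of `GlobalKummerNonInterference.lean`)

Proof-only companion (abc-iut cell, DISCHARGE-L6 §E2 LIST A, item A4) of
`Literature/IUT/LogThetaLattice/GlobalKummerNonInterference.lean` (S. Mochizuki, *Inter-universal
Teichmüller theory III*, kurims manuscript (May 2020), §3, Proposition 3.10 pp. 147–149, Remark
3.10.1 pp. 149–151; claim key Mochizuki2012, DISPUTED, D-0012). No new definitions.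

* **IUTchIII:Prop3.10(ii)** "(Non-interference with Local Integers)", p. 148: ALREADY PROVED in the
  typed file (`integralAtAllPlaces_iff_rootOfUnity` = Kronecker's theorem, and
  `Prop310ii_nonInterference` under the interface axiom `LocalMonoidsDetectIntegrality`). HERE the
  interface axiom itself is DISCHARGED for the intended model — the family of "nonzero local
  integers" of the number field indexed by its places, finite places `v` (elements of `v`-adic
  valuation `≤ 1`) and complex embeddings `φ` (elements with `|φ(x)| ≤ 1`, Example 3.6 (ii)):
  `localMonoidsDetectIntegrality_places`; whence the non-interference identity for that model with
  no hypothesis left (`Prop310ii_nonInterference_places`). Input: an element of a number field is an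
  algebraic integer iff its valuation is `≤ 1` at every finite place
  (`isIntegral_iff_forall_valuation_le_one`, Mathlib `HeightOneSpectrum.mem_integers_of_valuation_le_one`).
* **IUTchIII:Prop3.10(i)**, pp. 147–148: `VerticallyCoricGlobalData` is an OUTPUT SIGNATURE (data
  fields only): SLOT — nothing to prove until the vertically coric objects are constructed from
  Θ^{±ell}NF-Hodge theaters (NEEDS [IUTchI] Def. 6.13, [IUTchII] Cor. 4.7, 4.8).
* **IUTchIII:Prop3.10(iii)**, p. 149: `Prop310iii_compatible` is a predicate on abstract data; the
  tautological compatible family (transport of one Kummer isomorphism along the log-link maps, when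
  these are bijections) is recorded (`Prop310iii_compatible_of_transport`) only to exhibit that the
  predicate is inhabited as typed; the printed content NEEDS the Frobenioids `𝓕⊛_MOD`.
* Remark 3.10.1 (ii) as typed (`Remark3101ii_noKummerDetachmentIndeterminacy`: "any two compatible
  Kummer families agree") is REFUTED in the abstract setting whenever a compatible family exists
  and the coric object admits a non-identity permutation (`not_Remark3101ii_of_nontrivial_perm`):
  post-composition with a permutation of the coric object preserves compatibility. FINDING for the
  typer (abc-iut-L6-t4): the printed "no Kummer-detachment indeterminacy" is a statement relative
  to the identity indeterminacies of Prop. 3.10 (ii), not absolute uniqueness.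
-/

namespace Literature.IUT.LogThetaLattice

open NumberField IsDedekindDomain

universe u

section Places

variable (K : Type u) [Field K] [NumberField K]

/-- An element of a number field is an algebraic integer iff its `v`-adic valuation is `≤ 1` at
every finite place `v` ("integral at `v` for all `v ∈ 𝕍^non`"; [IUTchIII] proof of Proposition
3.10, p. 149, via [Lang] p. 144). Mathlib: `HeightOneSpectrum.valuation_le_one`,
`HeightOneSpectrum.mem_integers_of_valuation_le_one`. [claim: Mochizuki2012, status: disputed] -/
theorem isIntegral_iff_forall_valuation_le_one (x : K) :
    IsIntegral ℤ x ↔ ∀ v : HeightOneSpectrum (𝓞 K), v.valuation K x ≤ 1 := by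
  constructor
  · intro hx v
    obtain ⟨y, rfl⟩ := (IsIntegralClosure.isIntegral_iff (A := 𝓞 K)).mp hx
    exact v.valuation_le_one y
  · intro h
    obtain ⟨y, hy⟩ := HeightOneSpectrum.mem_integers_of_valuation_le_one (R := 𝓞 K) K x h
    rw [← hy]
    exact (IsIntegralClosure.isIntegral_iff (A := 𝓞 K) (R := ℤ)).mpr ⟨y, rfl⟩

/-- **The interface axiom `LocalMonoidsDetectIntegrality` of [IUTchIII] Prop. 3.10 (ii) (p. 148)
DISCHARGED for the intended model**: index the places of the number field `K` by
`𝕍 := {finite places} ⊔ {complex embeddings}` and let the local monoid at a finite place `v` be the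
nonzero elements of `v`-adic valuation `≤ 1`, at an embedding `φ` the nonzero elements with
`|φ(x)| ≤ 1` ("archimedean integers", Example 3.6 (ii)); then membership in all local monoids is
exactly "nonzero and integral at all places". [claim: Mochizuki2012, status: disputed] -/
theorem localMonoidsDetectIntegrality_places :
    LocalMonoidsDetectIntegrality (K := K)
      (fun v : HeightOneSpectrum (𝓞 K) ⊕ (K →+* ℂ) =>
        Sum.elim (fun w => {x : K | x ≠ 0 ∧ w.valuation K x ≤ 1})
          (fun φ => {x : K | x ≠ 0 ∧ ‖φ x‖ ≤ 1}) v) := by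
  have hne : Nonempty (K →+* ℂ) := by
    rw [← Fintype.card_pos_iff, NumberField.Embeddings.card]
    exact Module.finrank_pos
  obtain ⟨φ₀⟩ := hne
  intro x
  constructor
  · intro h
    refine ⟨(h (Sum.inr φ₀)).1, ?_, fun φ => (h (Sum.inr φ)).2⟩
    exact (isIntegral_iff_forall_valuation_le_one K x).mpr fun v => (h (Sum.inl v)).2
  · rintro ⟨hx0, hint, hle⟩ (v | φ)
    · exact ⟨hx0, (isIntegral_iff_forall_valuation_le_one K x).mp hint v⟩
    · exact ⟨hx0, hle φ⟩

/-- **IUTchIII:Prop3.10(ii)** (p. 148) for the intended model, with NO interface hypothesis left: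
the elements of the number field lying in every local monoid of integers (finite and archimedean
places) are exactly the roots of unity — `(†𝕄⊛_MOD)_α ∩ Π_{v∈𝕍} Ψ_{log(^{A,α}𝓕_v)} = (†𝕄⊛μ_MOD)_α`.
[claim: Mochizuki2012, status: disputed] -/
theorem Prop310ii_nonInterference_places :
    {x : K | ∀ v : HeightOneSpectrum (𝓞 K) ⊕ (K →+* ℂ),
        x ∈ Sum.elim (fun w => {x : K | x ≠ 0 ∧ w.valuation K x ≤ 1})
          (fun φ => {x : K | x ≠ 0 ∧ ‖φ x‖ ≤ 1}) v} =
      {x : K | ∃ n : ℕ, 0 < n ∧ x ^ n = 1} :=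
  Prop310ii_nonInterference _ (localMonoidsDetectIntegrality_places K)

end Places

section Coric

/-- **IUTchIII:Prop3.10(iii)** (p. 149), as typed (`Prop310iii_compatible`): when the log-link
maps `lg m` are bijections, transporting a single Kummer isomorphism at `m = 0` along them yields a
compatible family — recorded only to show the typed predicate is inhabited by abstract data; the
printed assertion concerns the Frobenioids `𝓕⊛_MOD`, not constructed here.
[claim: Mochizuki2012, status: disputed] -/
theorem Prop310iii_compatible_of_transport {C : Type u} (Ffrob : ℤ → Type u)
    (kum : ∀ m, Ffrob m ≃ C) (lg : ∀ m, Ffrob m ≃ Ffrob (m + 1))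
    (h : ∀ m, kum (m + 1) = (lg m).symm.trans (kum m)) :
    Prop310iii_compatible Ffrob kum fun m => lg m := by
  intro m x
  rw [h m]
  simp

/-- FINDING on Remark 3.10.1 (ii) as typed (`Remark3101ii_noKummerDetachmentIndeterminacy`, p. 150:
"Kummer-detachment indeterminacies do not arise", typed as: any two log-link-compatible Kummer
families coincide): in the abstract setting this uniqueness FAILS as soon as one compatible family
`kum` exists and the coric object `C` has a non-identity permutation `σ` — `σ ∘ kum m` is again
compatible. The printed statement is relative to the identity indeterminacies of Prop. 3.10 (ii);
the typed absolute form is too strong. [claim: Mochizuki2012, status: disputed] -/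
theorem not_Remark3101ii_of_nontrivial_perm {C : Type u} (Ffrob : ℤ → Type u)
    (lg : ∀ m, Ffrob m → Ffrob (m + 1)) (kum : ∀ m, Ffrob m ≃ C)
    (hkum : Prop310iii_compatible Ffrob kum lg) (σ : Equiv.Perm C) (hσ : σ ≠ 1)
    [Nonempty (Ffrob 0)] :
    ¬ Remark3101ii_noKummerDetachmentIndeterminacy (C := C) Ffrob lg := by
  intro huniq
  have hcompat : Prop310iii_compatible Ffrob (fun m => (kum m).trans σ) lg := fun m x => by
    simp only [Equiv.trans_apply, hkum m x]
  have heq := huniq kum (fun m => (kum m).trans σ) hkum hcompat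
  apply hσ
  ext c
  obtain ⟨x, hx⟩ := (kum 0).surjective c
  have h0 := congrArg (fun k : ∀ m, Ffrob m ≃ C => k 0 x) heq
  simp only [Equiv.trans_apply] at h0
  rw [← hx, ← h0]
  rfl

end Coric

end Literature.IUT.LogThetaLattice
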